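import Mathlib
import Summits.ABC.ABC.Statement
import Summits.ABC.ABC.Theorems.SoloBlindOmega3Corners
import Summits.ABC.ABC.Theorems.SoloBlindFourthCorner
import Summits.ABC.ABC.Theorems.SoloBlindShapeCExponent
import Summits.ABC.ABC.Theorems.SoloBlindShapeDExponent
import HarnessLib

/-!
# Shapes C and D of the ω = 3 atlas, assembled (solo-blind seat, session 5)

One kernel statement per shape, combining the exponent theorems (`shapeC_exponent`, `shapeD_exponent`,
`shapeD_even_exponent`) with the corner classifications (`sq_corner_classification`, `fourth_corner`):

* `shapeC_atlas` : `2^k p^m + 1 = q^n` (`p, q` odd primes, `n ≥ 2`) ⇒ `(n = 2 ∧ q ∈ {3,5,7,17}) ∨ (n = 4 ∧ q = 3) ∨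
  (n` odd prime `∧ q = 2^s + 1)` — so apart from `c ∈ {9, 25, 49, 289, 81}` shape C is a Nagell–Ljunggren equation
  `(q^ℓ - 1)/(q - 1) = p^m` at a Fermat-type prime base `q`.
* `shapeD_atlas` : `p^m + 1 = 2^k q^n` (`p, q` odd primes, `m ≥ 2`) ⇒ `(m = 2^e, e ≥ 1, k = 1)` (the equation is
  `x² + 1 = 2 yⁿ`) `∨ (m` odd prime `∧ p + 1 = 2^s)` (Nagell–Ljunggren at the base `-p`, `p` Mersenne).
-/

namespace Summit.ABC.ABC.Theorems

/-- The support of `2^k p^m q^n` has at most three primes. -/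
private theorem card_primeFactors_le_three {k m n p q : ℕ} (hp : p.Prime) (hq : q.Prime) :
    (1 * (2 ^ k * p ^ m) * q ^ n).primeFactors.card ≤ 3 := by
  have hsub : (1 * (2 ^ k * p ^ m) * q ^ n).primeFactors ⊆ {2, p, q} := by
    intro r hr
    have hr' := Nat.mem_primeFactors.mp hr
    have hrp : r.Prime := hr'.1
    have hrd : r ∣ 1 * (2 ^ k * p ^ m) * q ^ n := hr'.2.1
    rw [one_mul] at hrd
    simp only [Finset.mem_insert, Finset.mem_singleton]
    rcases (Nat.Prime.dvd_mul hrp).mp hrd with h1 | h1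
    · rcases (Nat.Prime.dvd_mul hrp).mp h1 with h2 | h2
      · exact Or.inl ((Nat.prime_dvd_prime_iff_eq hrp Nat.prime_two).mp (hrp.dvd_of_dvd_pow h2))
      · exact Or.inr (Or.inl ((Nat.prime_dvd_prime_iff_eq hrp hp).mp (hrp.dvd_of_dvd_pow h2)))
    · exact Or.inr (Or.inr ((Nat.prime_dvd_prime_iff_eq hrp hq).mp (hrp.dvd_of_dvd_pow h1)))
  exact (Finset.card_le_card hsub).trans Finset.card_le_three

/-- **Shape C, assembled.** If `p, q` are odd primes, `n ≥ 2` and `2^k p^m + 1 = q^n`, then `n = 2` with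
`q ∈ {3, 5, 7, 17}`, or `n = 4` with `q = 3`, or `n` is an odd prime and `q = 2^s + 1`. -/
theorem shapeC_atlas {k m n p q : ℕ} (hp : p.Prime) (hq : q.Prime) (hp2 : p ≠ 2) (hq2 : q ≠ 2) (hn : 2 ≤ n)
    (h : 2 ^ k * p ^ m + 1 = q ^ n) :
    (n = 2 ∧ (q = 3 ∨ q = 5 ∨ q = 7 ∨ q = 17)) ∨ (n = 4 ∧ q = 3) ∨
      (n.Prime ∧ n ≠ 2 ∧ ∃ s : ℕ, q = 2 ^ s + 1) := by
  rcases shapeC_exponent hp hq hp2 hq2 h with h1 | h2 | h4 | hℓ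
  · omega
  · subst h2
    refine Or.inl ⟨rfl, ?_⟩
    rcases sq_corner_classification hq h (card_primeFactors_le_three hp hq) with h' | h'
    · exact absurd h' hq2
    · exact h'
  · subst h4
    refine Or.inr (Or.inl ⟨rfl, ?_⟩)
    rcases fourth_corner hq h (card_primeFactors_le_three hp hq) with h' | h'
    · exact absurd h' hq2
    · exact h'
  · exact Or.inr (Or.inr hℓ)

/-- **Shape D, assembled.** If `p, q` are odd primes, `m ≥ 2` and `p^m + 1 = 2^k q^n`, then either `m = 2^e` with
`e ≥ 1` and `k = 1` (the equation is `x² + 1 = 2 yⁿ` with `x = p^(2^(e-1))`), or `m` is an odd prime and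
`p + 1 = 2^s`. -/
theorem shapeD_atlas {k m n p q : ℕ} (hp : p.Prime) (hq : q.Prime) (hp2 : p ≠ 2) (hq2 : q ≠ 2) (hm : 2 ≤ m)
    (h : p ^ m + 1 = 2 ^ k * q ^ n) :
    (∃ e : ℕ, 1 ≤ e ∧ m = 2 ^ e ∧ k = 1) ∨ (m.Prime ∧ m ≠ 2 ∧ ∃ s : ℕ, p + 1 = 2 ^ s) := by
  rcases shapeD_exponent hp hq hp2 hq2 (by omega) h with ⟨e, he⟩ | hℓ
  · refine Or.inl ⟨e, ?_, he, ?_⟩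
    · rcases e with _ | e
      · simp at he; omega
      · omega
    · rcases e with _ | e
      · simp at he; omega
      · have hme : m = 2 * 2 ^ e := by rw [he, pow_succ, mul_comm]
        rw [hme] at h
        exact shapeD_even_exponent (hp.odd_of_ne_two hp2) (hq.odd_of_ne_two hq2) h
  · exact Or.inr hℓ

end Summit.ABC.ABC.Theorems
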